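import Literature.NumberTheory.Automorphic.LocalUnitaryIntegralLevel
import Literature.NumberTheory.Automorphic.AdicCompletionLocalField
import Mathlib.MeasureTheory.Measure.Haar.Unique
import HarnessLib

/-!
# Haar measures on the local unitary groups `U(H)(L⁺_v)`: normalisation by `vol U(H)(𝒪_v) = 1` and transport
# under the local congruences `ψ_v` (Rogawski 1990 §14.2, §4.9; Platonov–Rapinchuk §5.1; Weil, *L'intégration* §9)

Topic `NumberTheory/Automorphic`; namespace `Literature.NumberTheory.Automorphic` (§2, generic) and
`Literature.NumberTheory.Automorphic.UnitaryGroup` (§1, §3).  THEOREMS ONLY (plus topological `instance`s on the tree's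
carriers, no measure or measurable-space instance): no definition, no named fact, no `sorry`.  Sequel of ★
`LocalUnitaryGroupCongr` (the local congruences `ψ_v : U(H)(L⁺_v) ≃ₜ* U(H')(L⁺_v)`, `cmDatumLocalCongr` …) and of ★
`LocalUnitaryIntegralLevel` (the integral levels `K_v = U(H)(𝒪_v) = cmLocalIntegralLevel L N H v`, compact open, and the
almost-everywhere LEVEL-MATCHING congruences `ψ_v K_v = K'_v`).

What a local comparison of orbital integrals or traces «`O_γ(f_v) = O_{ψγ}(f′_v)` for `v ∉ S₀ ∪ S`, `f_v = f′_v ∘ ψ_v⁻¹`»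
([Rogawski1990, §14.2 p. 233; §4.9]) needs from measure theory is typed here:

* §1 the local groups are LOCALLY COMPACT, SECOND COUNTABLE, HAUSDORFF topological groups (`«local» E c N J v` is a closed
  subgroup of `GL_N(∏_{w∣v} E_w)` — ★ `isClosed_local`; `E_w` is locally compact ★ and second countable ★), recorded as
  instances on `↥(«local» E c N J v)` and on the `cmDatum` carrier `(cmDatum L N H).Local v`; hence they CARRY Haar
  measures (Mathlib `MeasureTheory.Measure.haar`) once a Borel structure is chosen (always a hypothesis
  `[MeasurableSpace] [BorelSpace]` here, as in the tree's `AdelicGroupData` files — no measurable instance is declared);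
* §2 (generic, any locally compact groups) **normalisation and transport of Haar measures**:
  `exists_isHaarMeasure_apply_eq_one` (a compact set with non-empty interior — e.g. a compact open subgroup — can be given
  Haar measure `1`), `isHaarMeasure_eq_of_apply_eq` (second countable: that normalisation is UNIQUE),
  `exists_map_eq_smul_of_continuousMulEquiv` (for `e : G ≃ₜ* G'` and Haar measures `μ, μ'`: `e_* μ = c • μ'` with
  `0 < c`, i.e. `e` is measure preserving up to the constant `c = haarScalarFactor (e_* μ) μ'`),
  `measurePreserving_of_map_apply_eq` ∕ **`measurePreserving_of_forall_mem_iff`** (ON THE NOSE: if `e` matches one pair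
  of sets `K ↔ K'` of Haar measure `1` — `∀ g, e g ∈ K' ↔ g ∈ K`, `μ K = 1`, `μ' K' = 1` — then `MeasurePreserving e μ μ'`);
* §3 the CM packaging: **`exists_isHaarMeasure_cmLocalIntegralLevel_eq_one`** (the normalised local Haar measure
  `vol U(H)(𝒪_v) = 1` exists) and `isHaarMeasure_eq_of_cmLocalIntegralLevel_eq_one` (and is unique),
  `exists_map_cmDatumLocalCongr_eq_smul` (★ `cmDatumLocalCongr` transports Haar measures up to a positive constant),
  **`measurePreserving_of_cmLocalIntegralLevel_iff`** (a level-matching `ψ_v` is measure preserving for the normalised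
  measures), and the almost-everywhere statement **`eventually_exists_measurePreserving_levelMatching[_of_anisotropic]`**:
  for hermitian `H` with `det H ≠ 0` (resp. anisotropic), for all but finitely many `v` there is
  `ψ_v : U(H)(L⁺_v) ≃ₜ* U(Φ_N)(L⁺_v)` matching the integral levels AND measure preserving for every pair of Haar measures
  normalised by `vol(K_v) = vol(K'_v) = 1` (★ B9 `eventually_exists_continuousMulEquiv_cmLocalIntegralLevel_iff` + §2) —
  the measure clause of «`f_v = f′_v` for `v ∉ S₀ ∪ S`».

## References
* J. Rogawski, *Automorphic Representations of Unitary Groups in Three Variables* (1990), §14.2 p. 233, §4.9 [Rogawski1990].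
* V. Platonov, A. Rapinchuk, *Algebraic Groups and Number Theory* (1994), §5.1 (`G_{F_v}` locally compact, `G_{𝒪_v}`
  compact open), §3.5 (normalised Haar measures) [PlatonovRapinchuk1994].
* A. Weil, *L'intégration dans les groupes topologiques* (1940), §9; G. B. Folland, *A Course in Abstract Harmonic
  Analysis* (1995), Thm. 2.20 (uniqueness of Haar measure) [Folland1995].
-/

noncomputable section

open MeasureTheory Measure NumberField IsDedekindDomain Set
open scoped ENNReal NNReal Matrix

namespace Literature.NumberTheory.Automorphic

/-! ## §1 The local unitary groups are locally compact second countable groups -/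

namespace UnitaryGroup

variable {F E : Type} [Field F] [NumberField F] [Field E] [NumberField E] [Algebra F E]
  (c : E ≃ₐ[F] E) (N : ℕ) (J : Matrix (Fin N) (Fin N) E) (v : HeightOneSpectrum (𝓞 F))

/-- `E_v = ∏_{w ∣ v} E_w` is second countable (each `E_w` is, ★ `secondCountableTopology_adicCompletion`; finitely many
`w ∣ v`). [cite: PlatonovRapinchuk1994, §5.1] -/
theorem secondCountableTopology_localRing : SecondCountableTopology (LocalRing E v) := by
  haveI : ∀ w : PlacesOver E v, SecondCountableTopology (w.1.adicCompletion E) := fun w =>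
    secondCountableTopology_adicCompletion E w.1
  infer_instance

/-- `GL_N(E_v)` is locally compact (units topology; `E_v` is a locally compact Hausdorff ring — pattern of ★
`AdelicGroupData.locallyCompactSpace_generalLinearGroup_adeleRing`). [cite: PlatonovRapinchuk1994, §5.1] -/
theorem locallyCompactSpace_localGL : LocallyCompactSpace (GL (Fin N) (LocalRing E v)) := by
  haveI : LocallyCompactSpace (Matrix (Fin N) (Fin N) (LocalRing E v)) :=
    inferInstanceAs (LocallyCompactSpace (Fin N → Fin N → LocalRing E v))
  infer_instance

/-- `GL_N(E_v)` is second countable (embedding `g ↦ (g, g⁻¹)` into `M_N(E_v) × M_N(E_v)ᵐᵒᵖ` — pattern of ★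
`secondCountableTopology_generalLinearGroup_adeleRing`). [cite: PlatonovRapinchuk1994, §5.1] -/
theorem secondCountableTopology_localGL : SecondCountableTopology (GL (Fin N) (LocalRing E v)) := by
  haveI := secondCountableTopology_localRing (E := E) v
  haveI : SecondCountableTopology (Matrix (Fin N) (Fin N) (LocalRing E v)) :=
    inferInstanceAs (SecondCountableTopology (Fin N → Fin N → LocalRing E v))
  haveI : SecondCountableTopology (Matrix (Fin N) (Fin N) (LocalRing E v))ᵐᵒᵖ :=
    MulOpposite.opHomeomorph.symm.secondCountableTopology
  exact Units.isEmbedding_embedProduct.secondCountableTopology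

/-- **`U(J)(F_v)` is locally compact** (closed subgroup ★ `isClosed_local` of the locally compact `GL_N(E_v)`), so it
carries Haar measures. [cite: PlatonovRapinchuk1994, §5.1] -/
instance locallyCompactSpace_local : LocallyCompactSpace («local» E c N J v) :=
  haveI := locallyCompactSpace_localGL (E := E) N v
  (isClosed_local E c N J v).isClosedEmbedding_subtypeVal.locallyCompactSpace

/-- `U(J)(F_v)` is second countable. [cite: PlatonovRapinchuk1994, §5.1] -/
instance secondCountableTopology_local : SecondCountableTopology («local» E c N J v) :=
  haveI := secondCountableTopology_localGL (E := E) N v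
  TopologicalSpace.Subtype.secondCountableTopology _

section CM

variable (L : Type) [Field L] [NumberField L] [IsCMField L] (H : Matrix (Fin N) (Fin N) L)
  (v : HeightOneSpectrum (𝓞 ↥(maximalRealSubfield L)))

/-- `(cmDatum L N H).Local v = U(H)(L⁺_v)` is locally compact (it IS `↥(«local» …)`, `cmDatum_Local`). [cite: PlatonovRapinchuk1994, §5.1] -/
instance locallyCompactSpace_cmDatum_local : LocallyCompactSpace ((cmDatum L N H).Local v) :=
  locallyCompactSpace_local (IsCMField.complexConj L) N H v

/-- `(cmDatum L N H).Local v` is second countable. [cite: PlatonovRapinchuk1994, §5.1] -/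
instance secondCountableTopology_cmDatum_local : SecondCountableTopology ((cmDatum L N H).Local v) :=
  secondCountableTopology_local (IsCMField.complexConj L) N H v

/-- `(cmDatum L N H).Local v` is Hausdorff. [cite: PlatonovRapinchuk1994, §5.1] -/
instance t2Space_cmDatum_local : T2Space ((cmDatum L N H).Local v) :=
  inferInstanceAs (T2Space («local» L (IsCMField.complexConj L) N H v))

end CM

end UnitaryGroup

/-! ## §2 Normalised Haar measures and their transport under isomorphisms of topological groups (generic) -/

section Haar

variable {G G' : Type*} [Group G] [TopologicalSpace G] [IsTopologicalGroup G] [LocallyCompactSpace G]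
  [MeasurableSpace G] [BorelSpace G]
  [Group G'] [TopologicalSpace G'] [IsTopologicalGroup G'] [LocallyCompactSpace G'] [MeasurableSpace G'] [BorelSpace G']

/-- **Normalised Haar measure.**  A compact set with non-empty interior (e.g. a compact open subgroup `K`) has Haar measure
in `(0, ∞)`, so some Haar measure gives it measure `1` (`vol(K) = 1`, the standard local normalisation).
[cite: PlatonovRapinchuk1994, §3.5] -/
theorem exists_isHaarMeasure_apply_eq_one {s : Set G} (hs : IsCompact s) (hso : (interior s).Nonempty) :
    ∃ μ : Measure G, IsHaarMeasure μ ∧ μ s = 1 := by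
  have h0 : haar s ≠ 0 := fun h =>
    (isOpen_interior.measure_pos haar hso).ne' (measure_mono_null interior_subset h)
  have htop : haar s ≠ ∞ := hs.measure_lt_top.ne
  refine ⟨(haar s)⁻¹ • haar, IsHaarMeasure.smul _ (ENNReal.inv_ne_zero.2 htop) (ENNReal.inv_ne_top.2 h0), ?_⟩
  rw [Measure.smul_apply, smul_eq_mul, ENNReal.inv_mul_cancel h0 htop]

/-- **Uniqueness of the normalisation** (second countable group): two Haar measures agreeing on ONE set of positive
finite measure are equal (`μ = c • μ'` by uniqueness of Haar measure, and `c = 1` on that set). [cite: Folland1995, Thm. 2.20] -/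
theorem isHaarMeasure_eq_of_apply_eq [SecondCountableTopology G] (μ μ' : Measure G) [IsHaarMeasure μ] [IsHaarMeasure μ']
    {s : Set G} (h0 : μ' s ≠ 0) (htop : μ' s ≠ ∞) (h : μ s = μ' s) : μ = μ' := by
  have hc : μ = haarScalarFactor μ μ' • μ' := isMulLeftInvariant_eq_smul μ μ'
  suffices h1 : haarScalarFactor μ μ' = 1 by rw [hc, h1, one_smul]
  have h2 : (haarScalarFactor μ μ' : ℝ≥0∞) * μ' s = 1 * μ' s := by
    rw [one_mul, ← smul_eq_mul, ← ENNReal.smul_def, ← Measure.smul_apply, ← hc, h]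
  rwa [ENNReal.mul_left_inj h0 htop, ENNReal.coe_eq_one] at h2

omit [LocallyCompactSpace G] in
/-- **Transport up to a constant.**  For an isomorphism of topological groups `e : G ≃ₜ* G'` and Haar measures `μ` on `G`,
`μ'` on `G'` (`G'` second countable): `e_* μ = c • μ'` with `0 < c` — `e` is measure preserving from `μ` to `c • μ'`
(`e_* μ` is a Haar measure, Mathlib `ContinuousMulEquiv.isHaarMeasure_map`; uniqueness). [cite: Folland1995, Thm. 2.20] -/
theorem exists_map_eq_smul_of_continuousMulEquiv [SecondCountableTopology G'] (e : G ≃ₜ* G') (μ : Measure G)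
    [IsHaarMeasure μ] (μ' : Measure G') [IsHaarMeasure μ'] :
    ∃ c : ℝ≥0, 0 < c ∧ μ.map e = c • μ' :=
  ⟨haarScalarFactor (μ.map e) μ', haarScalarFactor_pos_of_isHaarMeasure _ _, isMulLeftInvariant_eq_smul _ _⟩

omit [IsTopologicalGroup G] [LocallyCompactSpace G] [IsTopologicalGroup G'] [LocallyCompactSpace G'] in
/-- The measure of a set under the transported measure: `(e_* μ) s = μ (e ⁻¹' s)` for EVERY set `s` (`e` is a measurable
equivalence). [cite: Folland1995, Thm. 2.20] -/
theorem map_continuousMulEquiv_apply (e : G ≃ₜ* G') (μ : Measure G) (s : Set G') : μ.map e s = μ (e ⁻¹' s) :=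
  e.toHomeomorph.toMeasurableEquiv.map_apply s

omit [LocallyCompactSpace G] in
/-- **Transport on the nose, from one matched set.**  If the Haar measures `μ, μ'` satisfy `μ (e ⁻¹' s) = μ' s` for one set
`s ⊆ G'` with `0 < μ' s < ∞`, then `e` is measure preserving: `e_* μ = μ'`. [cite: Folland1995, Thm. 2.20] -/
theorem measurePreserving_of_map_apply_eq [SecondCountableTopology G'] (e : G ≃ₜ* G') (μ : Measure G) [IsHaarMeasure μ]
    (μ' : Measure G') [IsHaarMeasure μ'] {s : Set G'} (h0 : μ' s ≠ 0) (htop : μ' s ≠ ∞) (h : μ (e ⁻¹' s) = μ' s) :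
    MeasurePreserving e μ μ' :=
  ⟨e.continuous.measurable,
    isHaarMeasure_eq_of_apply_eq (μ.map e) μ' h0 htop (by rw [map_continuousMulEquiv_apply, h])⟩

omit [LocallyCompactSpace G] in
/-- **Level-matching isomorphisms are measure preserving for the normalised measures.**  If `e : G ≃ₜ* G'` matches
`K ⊆ G` with `K' ⊆ G'` (`e g ∈ K' ↔ g ∈ K`) and the Haar measures are normalised by `μ K = 1`, `μ' K' = 1`, then
`MeasurePreserving e μ μ'` — the measure clause of «`f_v = f′_v ∘ ψ_v⁻¹` with `ψ_v(K_v) = K'_v`, `vol K_v = vol K'_v = 1`».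
[cite: Rogawski1990, §14.2 p. 233] [cite: Folland1995, Thm. 2.20] -/
theorem measurePreserving_of_forall_mem_iff [SecondCountableTopology G'] (e : G ≃ₜ* G') {K : Set G} {K' : Set G'}
    (hK : ∀ g, e g ∈ K' ↔ g ∈ K) (μ : Measure G) [IsHaarMeasure μ] (μ' : Measure G') [IsHaarMeasure μ']
    (hμ : μ K = 1) (hμ' : μ' K' = 1) : MeasurePreserving e μ μ' := by
  have hpre : e ⁻¹' K' = K := Set.ext fun g => hK g
  exact measurePreserving_of_map_apply_eq e μ μ' (by rw [hμ']; exact one_ne_zero) (by rw [hμ']; exact ENNReal.one_ne_top)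
    (by rw [hpre, hμ, hμ'])

end Haar

/-! ## §3 The CM packaging: `vol U(H)(𝒪_v) = 1` and the level-matching `ψ_v` -/

namespace UnitaryGroup

section CM

variable (L : Type) [Field L] [NumberField L] [IsCMField L] (N : ℕ)

/-- **The normalised local Haar measure exists**: on `U(H)(L⁺_v) = (cmDatum L N H).Local v` there is a Haar measure with
`vol U(H)(𝒪_v) = 1` (`cmLocalIntegralLevel` is a compact open subgroup, ★ `isCompact_isOpen_cmLocalIntegralLevel`).
[cite: PlatonovRapinchuk1994, §3.5] [cite: Rogawski1990, §4.9] -/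
theorem exists_isHaarMeasure_cmLocalIntegralLevel_eq_one (H : Matrix (Fin N) (Fin N) L)
    (v : HeightOneSpectrum (𝓞 ↥(maximalRealSubfield L))) [MeasurableSpace ((cmDatum L N H).Local v)]
    [BorelSpace ((cmDatum L N H).Local v)] :
    ∃ μ : Measure ((cmDatum L N H).Local v), IsHaarMeasure μ ∧ μ (cmLocalIntegralLevel L N H v) = 1 := by
  obtain ⟨hc, ho⟩ := isCompact_isOpen_cmLocalIntegralLevel L N H v
  exact exists_isHaarMeasure_apply_eq_one hc (by rw [ho.interior_eq]; exact ⟨1, (cmLocalIntegralLevel L N H v).one_mem⟩)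

/-- … and it is unique. [cite: Folland1995, Thm. 2.20] -/
theorem isHaarMeasure_eq_of_cmLocalIntegralLevel_eq_one (H : Matrix (Fin N) (Fin N) L)
    (v : HeightOneSpectrum (𝓞 ↥(maximalRealSubfield L))) [MeasurableSpace ((cmDatum L N H).Local v)]
    [BorelSpace ((cmDatum L N H).Local v)] (μ μ' : Measure ((cmDatum L N H).Local v)) [IsHaarMeasure μ] [IsHaarMeasure μ']
    (hμ : μ (cmLocalIntegralLevel L N H v) = 1) (hμ' : μ' (cmLocalIntegralLevel L N H v) = 1) : μ = μ' :=
  isHaarMeasure_eq_of_apply_eq μ μ' (by rw [hμ']; exact one_ne_zero) (by rw [hμ']; exact ENNReal.one_ne_top) (by rw [hμ, hμ'])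

variable {N}

/-- **Any local congruence transports Haar measures up to a positive constant**: for `ψ : U(H)(L⁺_v) ≃ₜ* U(H')(L⁺_v)`
(e.g. ★ `cmDatumLocalCongr`, ★ `cmDatumLocalSplitCongr`, ★ `cmDatumLocalNonsplitCongr`) and Haar measures `μ, μ'`:
`ψ_* μ = c • μ'`, `0 < c`. [cite: PlatonovRapinchuk1994, §3.5] [cite: Folland1995, Thm. 2.20] -/
theorem exists_map_eq_smul_of_cmDatum_local {H H' : Matrix (Fin N) (Fin N) L} {v : HeightOneSpectrum (𝓞 ↥(maximalRealSubfield L))}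
    [MeasurableSpace ((cmDatum L N H).Local v)] [BorelSpace ((cmDatum L N H).Local v)]
    [MeasurableSpace ((cmDatum L N H').Local v)] [BorelSpace ((cmDatum L N H').Local v)]
    (ψ : (cmDatum L N H).Local v ≃ₜ* (cmDatum L N H').Local v) (μ : Measure ((cmDatum L N H).Local v)) [IsHaarMeasure μ]
    (μ' : Measure ((cmDatum L N H').Local v)) [IsHaarMeasure μ'] :
    ∃ c : ℝ≥0, 0 < c ∧ μ.map ψ = c • μ' :=
  exists_map_eq_smul_of_continuousMulEquiv ψ μ μ'

/-- **A level-matching local congruence is measure preserving for the normalised Haar measures**: if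
`ψ : U(H)(L⁺_v) ≃ₜ* U(H')(L⁺_v)` satisfies `ψ g ∈ U(H')(𝒪_v) ↔ g ∈ U(H)(𝒪_v)` (★ B9
`eventually_exists_continuousMulEquiv_cmLocalIntegralLevel_iff`: this holds for a.e. `v`) and `vol U(H)(𝒪_v) = 1 =
vol U(H')(𝒪_v)`, then `ψ_* μ = μ'`: integrals of `f′_v ∘ ψ_v⁻¹` against `μ'` are integrals of `f′_v` against `μ`
([Rogawski1990, §14.2]: «for `v ∉ S₀ ∪ S` … `f_v = f′_v`»). [cite: Rogawski1990, §14.2 p. 233] -/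
theorem measurePreserving_of_cmLocalIntegralLevel_iff {H H' : Matrix (Fin N) (Fin N) L}
    {v : HeightOneSpectrum (𝓞 ↥(maximalRealSubfield L))}
    [MeasurableSpace ((cmDatum L N H).Local v)] [BorelSpace ((cmDatum L N H).Local v)]
    [MeasurableSpace ((cmDatum L N H').Local v)] [BorelSpace ((cmDatum L N H').Local v)]
    (ψ : (cmDatum L N H).Local v ≃ₜ* (cmDatum L N H').Local v)
    (hψ : ∀ g, ψ g ∈ cmLocalIntegralLevel L N H' v ↔ g ∈ cmLocalIntegralLevel L N H v)
    (μ : Measure ((cmDatum L N H).Local v)) [IsHaarMeasure μ] (μ' : Measure ((cmDatum L N H').Local v)) [IsHaarMeasure μ']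
    (hμ : μ (cmLocalIntegralLevel L N H v) = 1) (hμ' : μ' (cmLocalIntegralLevel L N H' v) = 1) :
    MeasurePreserving ψ μ μ' :=
  measurePreserving_of_forall_mem_iff ψ (K := (cmLocalIntegralLevel L N H v : Set ((cmDatum L N H).Local v)))
    (K' := (cmLocalIntegralLevel L N H' v : Set ((cmDatum L N H').Local v))) hψ μ μ' hμ hμ'

variable (N)

/-- **Almost everywhere, the local congruence to the quasi-split group is level matching AND measure preserving.**  For a
hermitian `H ∈ GL_N(L)`: for all but finitely many finite places `v` of `L⁺` there is `ψ_v : U(H)(L⁺_v) ≃ₜ* U(Φ_N)(L⁺_v)`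
(`Φ_N = antidiag(1,…,1)`) with `ψ_v(U(H)(𝒪_v)) = U(Φ_N)(𝒪_v)` which is measure preserving for EVERY choice of Borel
structures and of Haar measures normalised by `vol U(H)(𝒪_v) = vol U(Φ_N)(𝒪_v) = 1` (★ B9 + §2).
[cite: Rogawski1990, §14.2 p. 233] [cite: PlatonovRapinchuk1994, §5.1] -/
theorem eventually_exists_measurePreserving_levelMatching (H : Matrix (Fin N) (Fin N) L)
    (hH : (H.map (cmConjRingHom L))ᵀ = H) (hHd : IsUnit H.det) :
    ∀ᶠ v : HeightOneSpectrum (𝓞 ↥(maximalRealSubfield L)) in Filter.cofinite,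
      ∃ ψ : (cmDatum L N H).Local v ≃ₜ*
          (cmDatum L N (Matrix.of fun i j : Fin N => if i.val + j.val + 1 = N then (1 : L) else 0)).Local v,
        (∀ g, ψ g ∈ cmLocalIntegralLevel L N (Matrix.of fun i j : Fin N => if i.val + j.val + 1 = N then (1 : L) else 0) v ↔
          g ∈ cmLocalIntegralLevel L N H v) ∧
        ∀ [MeasurableSpace ((cmDatum L N H).Local v)] [BorelSpace ((cmDatum L N H).Local v)]
          [MeasurableSpace ((cmDatum L N (Matrix.of fun i j : Fin N => if i.val + j.val + 1 = N then (1 : L) else 0)).Local v)]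
          [BorelSpace ((cmDatum L N (Matrix.of fun i j : Fin N => if i.val + j.val + 1 = N then (1 : L) else 0)).Local v)]
          (μ : Measure ((cmDatum L N H).Local v)) [IsHaarMeasure μ]
          (μ' : Measure ((cmDatum L N (Matrix.of fun i j : Fin N => if i.val + j.val + 1 = N then (1 : L) else 0)).Local v))
          [IsHaarMeasure μ'],
          μ (cmLocalIntegralLevel L N H v) = 1 →
          μ' (cmLocalIntegralLevel L N (Matrix.of fun i j : Fin N => if i.val + j.val + 1 = N then (1 : L) else 0) v) = 1 →
          MeasurePreserving ψ μ μ' := by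
  filter_upwards [eventually_exists_continuousMulEquiv_cmLocalIntegralLevel_iff L N H hH hHd] with v hv
  obtain ⟨ψ, hψ⟩ := hv
  exact ⟨ψ, hψ, fun μ _ μ' _ hμ hμ' => measurePreserving_of_cmLocalIntegralLevel_iff L ψ hψ μ μ' hμ hμ'⟩

/-- The same for an ANISOTROPIC hermitian `H` (then `det H ≠ 0`, ★ `Godement.det_ne_zero_of_anisotropic`) — the binders
of the quasi-split comparison `G′ = U(H)` vs `G = U(Φ_N)`. [cite: Rogawski1990, §14.2 p. 233] -/
theorem eventually_exists_measurePreserving_levelMatching_of_anisotropic (H : Matrix (Fin N) (Fin N) L)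
    (hanis : ∀ x : Fin N → L, Literature.AlgebraicGeometry.ShimuraVarieties.hermForm (cmConjRingHom L) H x x = 0 → x = 0)
    (hH : (H.map (cmConjRingHom L))ᵀ = H) :
    ∀ᶠ v : HeightOneSpectrum (𝓞 ↥(maximalRealSubfield L)) in Filter.cofinite,
      ∃ ψ : (cmDatum L N H).Local v ≃ₜ*
          (cmDatum L N (Matrix.of fun i j : Fin N => if i.val + j.val + 1 = N then (1 : L) else 0)).Local v,
        (∀ g, ψ g ∈ cmLocalIntegralLevel L N (Matrix.of fun i j : Fin N => if i.val + j.val + 1 = N then (1 : L) else 0) v ↔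
          g ∈ cmLocalIntegralLevel L N H v) ∧
        ∀ [MeasurableSpace ((cmDatum L N H).Local v)] [BorelSpace ((cmDatum L N H).Local v)]
          [MeasurableSpace ((cmDatum L N (Matrix.of fun i j : Fin N => if i.val + j.val + 1 = N then (1 : L) else 0)).Local v)]
          [BorelSpace ((cmDatum L N (Matrix.of fun i j : Fin N => if i.val + j.val + 1 = N then (1 : L) else 0)).Local v)]
          (μ : Measure ((cmDatum L N H).Local v)) [IsHaarMeasure μ]
          (μ' : Measure ((cmDatum L N (Matrix.of fun i j : Fin N => if i.val + j.val + 1 = N then (1 : L) else 0)).Local v))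
          [IsHaarMeasure μ'],
          μ (cmLocalIntegralLevel L N H v) = 1 →
          μ' (cmLocalIntegralLevel L N (Matrix.of fun i j : Fin N => if i.val + j.val + 1 = N then (1 : L) else 0) v) = 1 →
          MeasurePreserving ψ μ μ' :=
  eventually_exists_measurePreserving_levelMatching L N H hH
    (isUnit_iff_ne_zero.2 (Godement.det_ne_zero_of_anisotropic L H hanis))

end CM

end UnitaryGroup

end Literature.NumberTheory.Automorphic

end
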